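import Summits.AtomisticToContinuum.BoseEinsteinCondensation.Theorems.BECCutLineWeakDisorderWitnessTransferCoreEntry
import Summits.AtomisticToContinuum.Crystallization.Theorems.PricedLinkCensusLocalToGlobalNewtonShell8
import Literature.Analysis.FluidPDE.NewtonKernel
import HarnessLib

/-!
# Route BECCutLineWeakDisorder — crux `WitnessTransfer`, line `Sketch`, stub (S7): Newton's
theorem for balls and shells (auxiliary file)

Support for the registered stub `stub_lintegral_radial_mul_inv_norm_sub_le` of line `Sketch`
(crux item stmt-AtomisticToContinuum-14978): the Newtonian potential `x ↦ ∫ g(‖w‖) ‖w − x‖⁻¹ dw`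
of a radial charge on `Space = ℝ³` is maximal at the centre.  This file proves the two halves of
Newton's shell theorem for UNIFORM balls and shells, from the ball mean value property of
harmonic functions (`setAverage_ball_eq_of_contDiffAt`, Gilbarg–Trudinger Thm 2.1, in the tree
under `Summits/AtomisticToContinuum/Crystallization/Theorems/…NewtonShell8`) applied to the
harmonic function `‖· − p‖⁻¹ = −4π Γ(· − p)` (`Γ` the Newton kernel of `ℝ³`,
`Literature.Analysis.FluidPDE.laplacian_newtonKernel`):

* `setLIntegral_ball_inv_norm_sub` — exterior points: `∫_{B(0,t)} ‖y − p‖⁻¹ dy = |B(0,t)|/‖p‖`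
  for `t < ‖p‖`;
* `setLIntegral_ball_shellPotential` — Tonelli: the ball averages `∫_{B(0,t)} Φ_S` of the
  potential `Φ_S(x) = ∫_S ‖w − x‖⁻¹ dw` of the uniform shell `S = {c < ‖w‖ < d}`, `t ≤ c`, are
  `|B(0,t)| Φ_S(0)`;
* `shellPotential_eq_of_norm_eq` — `Φ_S` is radial (reflection trick);
* `shellPotential_ae_eq` — interior points: `Φ_S(x) = Φ_S(0)` for a.e. `x ∈ B(0,c)` (the finite
  measures `Φ_S dλ` and `Φ_S(0) dλ`, `λ` the law of `‖x‖` on `B(0,c)`, agree on the π-system of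
  rays `(-∞, a)`, hence their densities agree `λ`-a.e.).

References: O. D. Kellogg, *Foundations of Potential Theory*, Ch. III §3; E. H. Lieb, M. Loss,
*Analysis*, Thm 9.7 (Newton's theorem).
-/

noncomputable section

open MeasureTheory ProbabilityTheory Filter Set Metric
open scoped ENNReal NNReal Topology Laplacian

namespace Summit.AtomisticToContinuum.BoseEinsteinCondensation.Theorems.CutLineWitness

open Literature.MathematicalPhysics.QuantumManyBody.BoseGas

/-! ### The point potential `‖· − p‖⁻¹` is harmonic off its pole -/

/-- The potential of a point charge, `y ↦ ‖y − p‖⁻¹`, is smooth off its pole `p`. [folklore] -/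
theorem contDiffAt_inv_norm_sub {p y : Space} (hy : y ≠ p) {n : WithTop ℕ∞} :
    ContDiffAt ℝ n (fun y : Space => ‖y - p‖⁻¹) y :=
  ((contDiffAt_id.sub contDiffAt_const).norm ℝ (sub_ne_zero.2 hy)).inv
    (norm_ne_zero_iff.2 (sub_ne_zero.2 hy))

/-- The potential of a point charge is harmonic off its pole: `Δ ‖· − p‖⁻¹ = 0` at every
`y ≠ p`, since `‖z‖⁻¹ = −4π Γ(z)` with `Γ` the Newton kernel of `ℝ³`, `Δ Γ = 0` off the origin
(`Literature.Analysis.FluidPDE.laplacian_newtonKernel`), translated to the pole `p`. [folklore] -/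
theorem laplacian_inv_norm_sub {p y : Space} (hy : y ≠ p) :
    (Δ (fun y : Space => ‖y - p‖⁻¹)) y = 0 := by
  have hfun : (fun y : Space => ‖y - p‖⁻¹) =
      (-(4 * Real.pi)) • fun y : Space => Literature.Analysis.FluidPDE.newtonKernel (-p + y) := by
    funext y
    simp only [Pi.smul_apply, smul_eq_mul, Literature.Analysis.FluidPDE.newtonKernel_eq,
      neg_add_eq_sub]
    have hπ : (4 * Real.pi : ℝ) ≠ 0 := by positivity
    rw [mul_inv, mul_neg, neg_mul, neg_neg, ← mul_assoc, mul_inv_cancel₀ hπ, one_mul]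
  have hne : -p + y ≠ 0 := by rwa [neg_add_eq_sub, sub_ne_zero]
  have hcd : ContDiffAt ℝ 2
      (fun y : Space => Literature.Analysis.FluidPDE.newtonKernel (-p + y)) y :=
    (Literature.Analysis.FluidPDE.contDiffAt_newtonKernel hne).comp y
      (contDiffAt_const.add contDiffAt_id)
  rw [hfun, InnerProductSpace.laplacian_smul _ hcd,
    Literature.Analysis.FluidPDE.laplacian_comp_const_add
      Literature.Analysis.FluidPDE.newtonKernel (-p) y,
    Literature.Analysis.FluidPDE.laplacian_newtonKernel hne, smul_zero]

/-! ### Newton's theorem for a ball and an exterior point -/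

/-- **Newton's theorem, exterior point.** For `0 < t < ‖p‖`,
`∫_{B(0,t)} ‖y − p‖⁻¹ dy = ‖p‖⁻¹ · |B(0,t)|`: the uniformly charged ball acts on the exterior
point `p` as a point charge at its centre — the ball mean value property of the harmonic
function `‖· − p‖⁻¹` on `B(0, ‖p‖) ⊇ B(0, t)` (Gilbarg–Trudinger, Thm 2.1). [folklore] -/
theorem setLIntegral_ball_inv_norm_sub (p : Space) {t : ℝ} (ht : 0 < t) (htp : t < ‖p‖) :
    ∫⁻ y in ball (0 : Space) t, ENNReal.ofReal ‖y - p‖⁻¹ =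
      ENNReal.ofReal ‖p‖⁻¹ * volume (ball (0 : Space) t) := by
  have hne : ∀ y ∈ ball (0 : Space) ‖p‖, y ≠ p := fun y hy hyp => by
    rw [hyp, mem_ball_zero_iff] at hy
    exact lt_irrefl _ hy
  have hmv : ⨍ y in ball (0 : Space) t, ‖y - p‖⁻¹ = ‖(0 : Space) - p‖⁻¹ :=
    Summit.AtomisticToContinuum.Crystallization.Theorems.PricedLinkCensusLocalToGlobal.setAverage_ball_eq_of_contDiffAt
      ht htp (fun y hy => contDiffAt_inv_norm_sub (hne y hy))
      (fun y hy => laplacian_inv_norm_sub (hne y (ball_subset_ball htp.le hy)))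
  rw [zero_sub, norm_neg] at hmv
  -- integrability on the ball: the integrand is continuous on the closed ball, which misses `p`
  have hcont : ContinuousOn (fun y : Space => ‖y - p‖⁻¹) (closedBall (0 : Space) t) := by
    refine fun y hy => ContinuousAt.continuousWithinAt ?_
    have hyp : y ≠ p := fun h => by
      rw [h, mem_closedBall_zero_iff] at hy
      exact absurd (hy.trans_lt htp) (lt_irrefl _)
    exact ((continuous_id.sub continuous_const).norm.continuousAt).inv₀
      (norm_ne_zero_iff.2 (sub_ne_zero.2 hyp))
  have hint : IntegrableOn (fun y : Space => ‖y - p‖⁻¹) (ball (0 : Space) t) :=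
    (hcont.integrableOn_compact (isCompact_closedBall 0 t)).mono_set ball_subset_closedBall
  have hnn : 0 ≤ᵐ[volume.restrict (ball (0 : Space) t)] fun y : Space => ‖y - p‖⁻¹ :=
    Eventually.of_forall fun y => inv_nonneg.2 (norm_nonneg _)
  have hfin : volume (ball (0 : Space) t) ≠ ∞ := measure_ball_lt_top.ne
  have hpos : 0 < volume.real (ball (0 : Space) t) :=
    ENNReal.toReal_pos (measure_ball_pos volume (0 : Space) ht).ne' hfin
  rw [setAverage_eq, smul_eq_mul] at hmv
  have hI : ∫ y in ball (0 : Space) t, ‖y - p‖⁻¹ = volume.real (ball (0 : Space) t) * ‖p‖⁻¹ := by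
    rw [← hmv, ← mul_assoc, mul_inv_cancel₀ hpos.ne', one_mul]
  rw [← ofReal_integral_eq_lintegral_ofReal hint hnn, hI, ENNReal.ofReal_mul measureReal_nonneg,
    measureReal_def, ENNReal.ofReal_toReal hfin, mul_comm]

/-! ### The potential of a uniform shell -/

/-- **Ball averages of the shell potential.** For the uniform shell `S = {c < ‖w‖ < d}` and a
ball `B(0,t)` with `0 < t ≤ c`:
`∫_{B(0,t)} (∫_S ‖w − x‖⁻¹ dw) dx = |B(0,t)| · ∫_S ‖w‖⁻¹ dw` — Tonelli, and Newton's theorem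
`setLIntegral_ball_inv_norm_sub` at every (exterior) point `w ∈ S`. [folklore] -/
theorem setLIntegral_ball_shellPotential {c d t : ℝ} (ht : 0 < t) (htc : t ≤ c) :
    ∫⁻ x in ball (0 : Space) t,
        ∫⁻ w in (fun w : Space => ‖w‖) ⁻¹' Ioo c d, ENNReal.ofReal ‖w - x‖⁻¹ =
      volume (ball (0 : Space) t) *
        ∫⁻ w in (fun w : Space => ‖w‖) ⁻¹' Ioo c d, ENNReal.ofReal ‖w‖⁻¹ := by
  have hS : MeasurableSet ((fun w : Space => ‖w‖) ⁻¹' Ioo c d) :=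
    measurable_norm measurableSet_Ioo
  rw [lintegral_lintegral_swap
    (((measurable_snd.sub measurable_fst).norm.inv).ennreal_ofReal).aemeasurable]
  have h : ∀ w ∈ (fun w : Space => ‖w‖) ⁻¹' Ioo c d,
      ∫⁻ x in ball (0 : Space) t, ENNReal.ofReal ‖w - x‖⁻¹ =
        ENNReal.ofReal ‖w‖⁻¹ * volume (ball (0 : Space) t) := fun w hw => by
    simp_rw [norm_sub_rev w]
    exact setLIntegral_ball_inv_norm_sub w ht (htc.trans_lt hw.1)
  rw [setLIntegral_congr_fun hS h, lintegral_mul_const' _ _ measure_ball_lt_top.ne, mul_comm]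

/-- **The shell potential is radial.** For any `L ⊆ ℝ`, the potential
`x ↦ ∫_{‖w‖ ∈ L} ‖w − x‖⁻¹ dw` of the radial set `{‖w‖ ∈ L}` depends only on `‖x‖`: reflect `x`
to `x'` (linear isometries preserve Lebesgue measure and norms; cf.
`ballIntegral_eq_of_norm_eq`). [folklore] -/
theorem shellPotential_eq_of_norm_eq (L : Set ℝ) {x x' : Space} (h : ‖x‖ = ‖x'‖) :
    ∫⁻ w in (fun w : Space => ‖w‖) ⁻¹' L, ENNReal.ofReal ‖w - x‖⁻¹ =
      ∫⁻ w in (fun w : Space => ‖w‖) ⁻¹' L, ENNReal.ofReal ‖w - x'‖⁻¹ := by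
  -- the reflection taking `x` to `x'`
  set R : Space ≃ₗᵢ[ℝ] Space := Submodule.reflection (ℝ ∙ (x - x'))ᗮ with hR
  have hRx : R x = x' := Submodule.reflection_sub h
  have hmp : MeasurePreserving R volume volume := R.measurePreserving
  have hemb : MeasurableEmbedding R := R.toHomeomorph.measurableEmbedding
  have hpre : R ⁻¹' ((fun w : Space => ‖w‖) ⁻¹' L) = (fun w : Space => ‖w‖) ⁻¹' L := by
    ext u
    simp only [mem_preimage, LinearIsometryEquiv.norm_map]
  symm
  calc ∫⁻ w in (fun w : Space => ‖w‖) ⁻¹' L, ENNReal.ofReal ‖w - x'‖⁻¹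
      = ∫⁻ u in R ⁻¹' ((fun w : Space => ‖w‖) ⁻¹' L), ENNReal.ofReal ‖R u - x'‖⁻¹ :=
        (hmp.setLIntegral_comp_preimage_emb hemb (fun w => ENNReal.ofReal ‖w - x'‖⁻¹) _).symm
    _ = ∫⁻ u in (fun w : Space => ‖w‖) ⁻¹' L, ENNReal.ofReal ‖u - x‖⁻¹ := by
        rw [hpre]
        refine lintegral_congr fun u => ?_
        rw [← hRx, ← map_sub, LinearIsometryEquiv.norm_map]

/-- **Newton's theorem, interior points (a.e. form).** For `0 < c` and the uniform shell
`S = {c < ‖w‖ < d}` (empty if `d ≤ c`): for a.e. `x` with `‖x‖ < c`, `∫_S ‖w − x‖⁻¹ dw = ∫_S ‖w‖⁻¹ dw` — the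
potential of the shell is constant inside.  Proof: `Φ_S(x) = ∫_S ‖w − x‖⁻¹ dw` is radial
(`shellPotential_eq_of_norm_eq`), `Φ_S = φ(‖·‖)`, and its ball averages are
`∫_{B(0,t)} Φ_S = |B(0,t)| Φ_S(0)` for all `t ≤ c` (`setLIntegral_ball_shellPotential`); so the
finite measures `Φ_S(0) λ` and `φ λ` on `ℝ`, `λ` the law of `‖x‖` under Lebesgue measure on
`B(0,c)`, agree on the π-system of rays `(-∞, a)` generating the Borel σ-algebra, hence are
equal, hence `φ = Φ_S(0)` `λ`-a.e. [folklore] -/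
theorem shellPotential_ae_eq {c d : ℝ} (hc : 0 < c) :
    ∀ᵐ x : Space, ‖x‖ < c →
      ∫⁻ w in (fun w : Space => ‖w‖) ⁻¹' Ioo c d, ENNReal.ofReal ‖w - x‖⁻¹ =
        ∫⁻ w in (fun w : Space => ‖w‖) ⁻¹' Ioo c d, ENNReal.ofReal ‖w‖⁻¹ := by
  set S : Set Space := (fun w : Space => ‖w‖) ⁻¹' Ioo c d with hS_def
  set Φ : Space → ℝ≥0∞ := fun x => ∫⁻ w in S, ENNReal.ofReal ‖w - x‖⁻¹ with hΦ_def
  set C : ℝ≥0∞ := ∫⁻ w in S, ENNReal.ofReal ‖w‖⁻¹ with hC_def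
  -- `Φ` is measurable and `C < ∞`
  have hΦm : Measurable Φ :=
    Measurable.lintegral_prod_right (ν := volume.restrict S)
      (f := fun (x : Space) (w : Space) => ENNReal.ofReal ‖w - x‖⁻¹)
      ((measurable_snd.sub measurable_fst).norm.inv).ennreal_ofReal
  have hSsub : S ⊆ ball (0 : Space) d := fun w hw => mem_ball_zero_iff.2 hw.2
  have hSfin : volume S < ∞ := (measure_mono hSsub).trans_lt measure_ball_lt_top
  have hCfin : C ≠ ∞ := by
    refine ne_top_of_le_ne_top ?_ (setLIntegral_mono measurable_const
      fun w hw => ENNReal.ofReal_le_ofReal (inv_anti₀ hc hw.1.le))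
    rw [setLIntegral_const]
    exact (ENNReal.mul_lt_top ENNReal.ofReal_lt_top hSfin).ne
  -- `Φ` is radial, with measurable profile `φ`
  obtain ⟨e, he⟩ : ∃ e : Space, ‖e‖ = 1 := exists_norm_eq Space zero_le_one
  set φ : ℝ → ℝ≥0∞ := fun r => Φ (r • e) with hφ_def
  have hφm : Measurable φ := hΦm.comp (continuous_id.smul continuous_const).measurable
  have hΦφ : ∀ x, Φ x = φ ‖x‖ := fun x => by
    have hn : ‖x‖ = ‖(‖x‖ • e : Space)‖ := by rw [norm_smul, norm_norm, he, mul_one]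
    exact shellPotential_eq_of_norm_eq (Ioo c d) hn
  -- ball averages of `Φ`
  have hball : ∀ a : ℝ, ∫⁻ x in ball (0 : Space) (min a c), Φ x =
      volume (ball (0 : Space) (min a c)) * C := fun a => by
    rcases le_or_gt (min a c) 0 with h0 | h0
    · rw [Metric.ball_eq_empty.2 h0, Measure.restrict_empty, lintegral_zero_measure,
        measure_empty, zero_mul]
    · exact setLIntegral_ball_shellPotential h0 (min_le_right a c)
  -- the law `lam` of `‖x‖` on `B(0,c)` and the two finite measures `C • lam`, `φ • lam`
  set μ0 : Measure Space := volume.restrict (ball (0 : Space) c) with hμ0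
  set lam : Measure ℝ := Measure.map (fun x : Space => ‖x‖) μ0 with hlam
  haveI hμ0f : IsFiniteMeasure μ0 := by
    rw [hμ0]
    exact isFiniteMeasure_restrict.2 measure_ball_lt_top.ne
  have hpre : ∀ a : ℝ, (fun x : Space => ‖x‖) ⁻¹' Iio a ∩ ball (0 : Space) c =
      ball (0 : Space) (min a c) := fun a => by
    ext x
    simp
  have hmeas : ∀ a : ℝ, MeasurableSet ((fun x : Space => ‖x‖) ⁻¹' Iio a) := fun a =>
    measurable_norm measurableSet_Iio
  have hlamIio : ∀ a : ℝ, lam (Iio a) = volume (ball (0 : Space) (min a c)) := fun a => by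
    rw [hlam, Measure.map_apply measurable_norm measurableSet_Iio, hμ0,
      Measure.restrict_apply (hmeas a), hpre a]
  have hL : ∀ a : ℝ, (lam.withDensity fun _ => C) (Iio a) =
      C * volume (ball (0 : Space) (min a c)) := fun a => by
    rw [withDensity_apply _ measurableSet_Iio, setLIntegral_const, hlamIio a]
  have hR : ∀ a : ℝ, (lam.withDensity φ) (Iio a) =
      volume (ball (0 : Space) (min a c)) * C := fun a => by
    rw [withDensity_apply _ measurableSet_Iio, hlam, setLIntegral_map measurableSet_Iio hφm
      measurable_norm, hμ0, Measure.restrict_restrict (hmeas a), hpre a, ← hball a]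
    exact lintegral_congr fun x => (hΦφ x).symm
  have key : (lam.withDensity fun _ => C) = lam.withDensity φ := by
    refine Measure.ext_of_generateFrom_of_iUnion (range Iio) (fun n : ℕ => Iio (n : ℝ))
      (BorelSpace.measurable_eq.trans (borel_eq_generateFrom_Iio ℝ)) isPiSystem_Iio ?_
      (fun n => ⟨n, rfl⟩) (fun n => ?_) ?_
    · refine eq_univ_of_forall fun r => mem_iUnion.2 ?_
      obtain ⟨n, hn⟩ := exists_nat_gt r
      exact ⟨n, hn⟩
    · rw [hL]
      exact ENNReal.mul_ne_top hCfin measure_ball_lt_top.ne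
    · rintro _ ⟨a, rfl⟩
      rw [hL, hR, mul_comm]
  -- hence the densities agree `lam`-a.e., i.e. `Φ = C` a.e. on `B(0,c)`
  have hCint : ∫⁻ _ : ℝ, C ∂lam ≠ ∞ := by
    rw [lintegral_const]
    exact ENNReal.mul_ne_top hCfin (measure_ne_top lam _)
  have hae : (fun _ => C) =ᵐ[lam] φ :=
    (withDensity_eq_iff measurable_const.aemeasurable hφm.aemeasurable hCint).1 key
  have h2 : ∀ᵐ x ∂μ0, C = φ ‖x‖ := ae_of_ae_map measurable_norm.aemeasurable hae
  rw [hμ0, ae_restrict_iff' measurableSet_ball] at h2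
  filter_upwards [h2] with x hx hxc
  show Φ x = C
  rw [hΦφ x]
  exact (hx (mem_ball_zero_iff.2 hxc)).symm

end Summit.AtomisticToContinuum.BoseEinsteinCondensation.Theorems.CutLineWitness

end
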